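import Summits.CriticalPhenomena.PercolationContinuityZ3.Theorems.PercNearOneGluingNoHeavyLowerTailSahiCombZsumReading

/-!
# The TOP-SUPPORT reading rule: a coefficient is read off an antipodal coordinate whenever nothing above it pollutes

Support file of the one-cut programme (crux `NoHeavyLowerTail`, stmt-CriticalPhenomena-4575; cell `prim-masterthm`, seat P5 gen 29;
memo `FROM-prim-masterthm-p5-g29-HALFCHAIN-PROOF.md` §5).  Addition to the reading toolkit of `…SahiCombZsumReading` (prim-lf-1 gen 38) used by the kernel
proofs of levelled inclusion designs (RANK-Z, AN♯1, AN♯3, the half-chain kernel `…TriWHalfChainKernel` of this seat).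

The diagonal-reading lemmas of `…ZsumReading` split a vanishing zeta combination into a DIAGONAL class (indices `d` with `dᶜ ∈ Y`) and foreign
classes with coordinates on `refl (Y ∩ Z)`.  The rule below is the pointwise form behind all of them (it is rule R2 of P5 gen 16's type-level prover
`cprove2` in full generality, and the induction step of any "top-down" elimination):

* **`FiveUpSet.eq_zero_of_zsum_eq_zero_top`** — `Y` an up-set, `zsum φ = 0` on `Y`, `e` an index with `eᶜ ∈ Y`; if every STRICT superset `d ⊋ e`
  carrying a non-zero coefficient `φ d ≠ 0` has `dᶜ ∈ Y` (is itself a basis index), then `φ e = 0`.  Proof: expand every `ζ_d|_Y` by the support lemma;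
  the coordinate of `zsum φ|_Y` at `ζ_e` is `φ e` plus contributions `φ d · c_d(e)` from `d ⊋ e` with `dᶜ ∉ Y`, which vanish by hypothesis; C1 on `Y`.
* **`FiveUpSet.eq_zero_of_zsum_eq_zero_of_forall_ssup`** — the form used in downward inductions on the index: if ALL strict supersets of `e` carry
  zero coefficients, then `φ e = 0` (for every `e` with `eᶜ ∈ Y`).
HONEST LABEL: elementary linear algebra over `ℚ` (std axioms); no inequality is proved in this file. [this work]
-/

namespace Summit.CriticalPhenomena.PercolationContinuityZ3.Theorems

namespace FiveUpSet

open Finset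

variable {α : Type} [DecidableEq α] [Fintype α]

/-- **TOP-SUPPORT READING.**  `Y` an up-set of the cube, `φ` any coefficient vector with `zsum φ = 0` on `Y`, `e` an index with `eᶜ ∈ Y`.  If every
strict superset `d` of `e` with `φ d ≠ 0` satisfies `dᶜ ∈ Y`, then `φ e = 0`. [this work] -/
theorem eq_zero_of_zsum_eq_zero_top {Y : Finset (Finset α)} (hY : IsUpperSet (Y : Set (Finset α))) (φ : Finset α → ℚ)
    (h : ∀ t, t ∈ Y → zsum φ t = 0) (e : Finset α) (he : eᶜ ∈ Y)
    (htop : ∀ d, e ⊆ d → e ≠ d → φ d ≠ 0 → dᶜ ∈ Y) : φ e = 0 := by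
  -- support lemma on `Y`, one coefficient vector per index `d`
  choose c hcδ hcsupp hcid using fun d => exists_support_coef hY d
  -- the coordinate vector of `zsum φ|_Y` in the antipodal basis (expand EVERY index, diagonal ones by themselves)
  obtain ⟨g, hg⟩ : ∃ f : Finset α → ℚ, ∀ e', f e' = ∑ d, φ d * c d e' := ⟨_, fun _ => rfl⟩
  have hexp : ∀ t, t ∈ Y → zsum φ t = ∑ e', g e' * (if e' ⊆ t then (1 : ℚ) else 0) := by
    intro t ht
    have hR : ∑ e', g e' * (if e' ⊆ t then (1 : ℚ) else 0) = ∑ e', (∑ d, φ d * c d e') * (if e' ⊆ t then (1 : ℚ) else 0) :=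
      Finset.sum_congr rfl fun e' _ => by rw [hg e']
    rw [hR]
    unfold zsum
    symm
    calc ∑ e', (∑ d, φ d * c d e') * (if e' ⊆ t then (1 : ℚ) else 0)
        = ∑ e', ∑ d, φ d * (c d e' * (if e' ⊆ t then (1 : ℚ) else 0)) := by
          refine sum_congr rfl fun e' _ => ?_
          rw [Finset.sum_mul]
          refine sum_congr rfl fun d _ => ?_
          ring
      _ = ∑ d, ∑ e', φ d * (c d e' * (if e' ⊆ t then (1 : ℚ) else 0)) := Finset.sum_comm
      _ = ∑ d, φ d * ∑ e', c d e' * (if e' ⊆ t then (1 : ℚ) else 0) := by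
          refine sum_congr rfl fun d _ => ?_
          rw [Finset.mul_sum]
      _ = ∑ d, φ d * (if d ⊆ t then (1 : ℚ) else 0) := by
          refine sum_congr rfl fun d _ => ?_
          rw [← hcid d t ht]
  -- `g` is supported on `refl Y`
  have hgsupp : ∀ e', g e' ≠ 0 → e'ᶜ ∈ Y := by
    intro e' he'
    rw [hg e'] at he'
    obtain ⟨d, -, hd⟩ := Finset.exists_ne_zero_of_sum_ne_zero he'
    exact (hcsupp d e' (right_ne_zero_of_mul hd)).1
  -- C1 on `Y`: all coordinates vanish
  have hzero : ∀ e', g e' = 0 := by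
    refine eq_zero_of_zeta_sum_eq_zero hY g hgsupp ?_
    intro t ht
    rw [← hexp t ht]
    exact h t ht
  -- the coordinate at `e` is `φ e`: the diagonal index contributes itself, a strict superset `d` contributes `φ d · c d e`, which vanishes
  have hge : g e = φ e := by
    rw [hg e]
    have hsingle : ∑ d, φ d * c d e = φ e * c e e := by
      refine Finset.sum_eq_single e ?_ ?_
      · intro d _ hde
        by_cases hφ : φ d = 0
        · rw [hφ, zero_mul]
        · by_cases hc : c d e = 0
          · rw [hc, mul_zero]
          · exfalso
            have hed : e ⊆ d := (hcsupp d e hc).2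
            have hdY : dᶜ ∈ Y := htop d hed (fun h' => hde h'.symm) hφ
            -- `dᶜ ∈ Y`: the expansion of `ζ_d` is trivial, so `c d e = [e = d] = 0`
            have hcd : c d = fun e' => if e' = d then 1 else 0 := hcδ d hdY
            rw [hcd] at hc
            have hne : e ≠ d := fun h' => hde h'.symm
            apply hc
            show (if e = d then (1 : ℚ) else 0) = 0
            rw [if_neg hne]
      · intro hmem; exact absurd (Finset.mem_univ e) hmem
    rw [hsingle]
    have hce : c e = fun e' => if e' = e then 1 else 0 := hcδ e he
    rw [hce]
    simp
  rw [← hge]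
  exact hzero e

/-- **Downward-induction form**: `zsum φ = 0` on the up-set `Y`, `eᶜ ∈ Y`, and `φ d = 0` for every strict superset `d` of `e` ⟹ `φ e = 0`. [this work] -/
theorem eq_zero_of_zsum_eq_zero_of_forall_ssup {Y : Finset (Finset α)} (hY : IsUpperSet (Y : Set (Finset α))) (φ : Finset α → ℚ)
    (h : ∀ t, t ∈ Y → zsum φ t = 0) (e : Finset α) (he : eᶜ ∈ Y) (hsup : ∀ d, e ⊆ d → e ≠ d → φ d = 0) : φ e = 0 :=
  eq_zero_of_zsum_eq_zero_top hY φ h e he (fun d hed hne hφ => absurd (hsup d hed hne) hφ)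

end FiveUpSet

end Summit.CriticalPhenomena.PercolationContinuityZ3.Theorems
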